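import Summits.ResolutionOfSingularities.ResolutionOfSingularities.Theorems.WildQuotientsSummitReductionOfDeJong1997Theorem59Reduction
import HarnessLib

/-!
# Crux `WildQuotients.SummitReduction` (stmt-ResolutionOfSingularities-16324) — line `FramePerfect`,
# CLOSED MODULO ONE NAMED FACT: `SummitReduction` from de Jong 1997, Thm. 5.9 (relative dimension 1)
# (part 2/6 — the reduction to a `G`-semi-stable pair `pair_reductionToSemiStablePair` = 1a ∘ 1b ∘ ih ∘ 1c (de Jong 1997, 5.2))

Route `ResolutionOfSingularities/WildQuotients`, crux `SummitReduction` (stmt-ResolutionOfSingularities-16324):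
one part of the line skeleton `Cruxes/SummitReduction/Lines/FramePerfect.lean` (v12, lead prover c4) with its
one remaining stub — the Literature NAMED FACT `DeJong1997_quasiSplitSemiStableCurveFibration` (de Jong
1997, Thm. 5.9 in relative dimension 1) — turned into the hypothesis `h59`; the story, the map of the ~115
landed helper files and the conditional crux `summitReduction_of_deJong1997Theorem59` are in the last part,
`WildQuotientsSummitReductionOfDeJong1997Theorem59.lean`. [cite: DeJong1997, Thm. 5.9, Prop. 5.11, Thm. 5.13, pp. 613–620]
[cite: DeJong1996, 3.2–3.5, 4.23–4.28, 7.1–7.3, pp. 62–65, 75–76, 87–88]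
-/

set_option linter.dupNamespace false

noncomputable section

open CategoryTheory CategoryTheory.Limits AlgebraicGeometry TopologicalSpace
open Literature.AlgebraicGeometry.Resolution Literature.AlgebraicGeometry.RelativeSpec
open Literature.AlgebraicGeometry.Motives (RatFn.functionFieldMap RatFn.functionFieldMap_comp)
open Literature.AlgebraicGeometry

namespace Summit.ResolutionOfSingularities.ResolutionOfSingularities.Theorems

/-! ## v5 stub 1, proved: 1a (LANDED p138150), 1b, the induction hypothesis on the base, 1c -/

/-- **De Jong 1997, proof of Thm. 5.13 (first half) over `S = Spec k`, `k` perfect** (v5's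
`stub_pair_reductionToSemiStablePair`, with `Y'` projective added to the conclusion in v7): from the
pair statement in dimension `≤ d` and a projective pair `(X, G, Z)` of dimension `d + 1`, a
`G'`-semi-stable pair over a REGULAR projective base with `G'`-strict sncd boundary and its Galois
link to `(X, G, Z)` — fibre (`stub_pair_equivariantFibration`, landed), reduce semi-stably over a
Galois alteration of the base (1b), resolve the base pair by the induction hypothesis, pull back (1c).
[cite: DeJong1997, proof of Thm. 5.13, p. 620] -/
theorem pair_reductionToSemiStablePair (h59 : DeJong1997_quasiSplitSemiStableCurveFibration.{0}) (k : Type) [Field k] [PerfectField k] (d : ℕ)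
    (ih : ∀ (X : Scheme.{0}) [IsIntegral X] (f : X ⟶ Spec (.of k)),
        Motives.IsProjectiveOver (Over.mk f) →
        ∀ (G : Type) [Group G] [Finite G] (ρ : G →* Aut X), (∀ g : G, (ρ g).hom ≫ f = f) →
        ∀ (Z : Set X), IsClosed Z → Z ≠ Set.univ → (∀ g : G, (ρ g).hom.base '' Z ⊆ Z) →
        topologicalKrullDim X ≤ (d : ℕ) →
        ∃ (G₁ : Type) (_ : Group G₁) (_ : Finite G₁) (X₁ : Scheme.{0}) (_ : IsIntegral X₁)
          (ρ₁ : G₁ →* Aut X₁) (φ₁ : G₁ →* G) (π₁ : X₁ ⟶ X) (_ : IsDominant π₁),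
          Function.Surjective φ₁ ∧ IsAlteration π₁ ∧ Scheme.IsRegular X₁ ∧
          Motives.IsProjectiveOver (Over.mk (π₁ ≫ f)) ∧
          (∀ g : G₁, (ρ₁ g).hom ≫ π₁ = π₁ ≫ (ρ (φ₁ g)).hom) ∧
          (∀ a : X₁.functionField, (∀ g : G₁, RatFn.functionFieldMap (ρ₁ g).hom a = a) →
            ∃ (n : ℕ) (c : X.functionField), (∀ g : G, RatFn.functionFieldMap (ρ g).hom c = c) ∧
              a ^ ringExpChar X.functionField ^ n = RatFn.functionFieldMap π₁ c) ∧
          ∃ D₁ : Set X₁, IsStrictNormalCrossingsDivisor X₁ D₁ ∧ π₁.base ⁻¹' (Z) ⊆ D₁ ∧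
            (∀ g : G₁, (ρ₁ g).hom.base '' D₁ = D₁) ∧
            (∀ (g : G₁) (C : Set X₁), Maximal (fun C : Set X₁ => IsIrreducible C ∧ C ⊆ D₁) C →
              (C ∩ (ρ₁ g).hom.base '' C).Nonempty → (ρ₁ g).hom.base '' C = C))
    (X : Scheme.{0}) [IsIntegral X] (f : X ⟶ Spec (.of k))
    (hproj : Motives.IsProjectiveOver (Over.mk f))
    (G : Type) [Group G] [Finite G] (ρ : G →* Aut X) (hρ : ∀ g : G, (ρ g).hom ≫ f = f)
    (Z : Set X) (hZ : IsClosed Z) (hZne : Z ≠ Set.univ)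
    (hZG : ∀ g : G, (ρ g).hom.base '' Z ⊆ Z)
    (hdim : topologicalKrullDim X = (d + 1 : ℕ)) :
    ∃ (G' : Type) (_ : Group G') (_ : Finite G') (X' Y' : Scheme.{0}) (_ : IsIntegral X')
      (_ : IsIntegral Y') (f' : X' ⟶ Y') (q' : Y' ⟶ Spec (.of k)) (ρX' : G' →* Aut X')
      (ρY' : G' →* Aut Y') (D' : Set Y') (hD' : IsStrictNormalCrossingsDivisor Y' D') (m : ℕ)
      (τ : Fin m → (Y' ⟶ X')),
      Motives.IsProjectiveOver (Over.mk (f' ≫ q')) ∧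
      Motives.IsProjectiveOver (Over.mk q') ∧
      Scheme.IsRegular Y' ∧
      (∀ g : G', (ρY' g).hom.base '' D' = D') ∧
      (∀ (g : G') (C : Set Y'), Maximal (fun C : Set Y' => IsIrreducible C ∧ C ⊆ D') C →
        (C ∩ (ρY' g).hom.base '' C).Nonempty → (ρY' g).hom.base '' C = C) ∧
      IsSemiStableCurve f' ∧
      (∀ x : X', (¬ ∃ U : X'.Opens, x ∈ U ∧ Smooth (U.ι ≫ f')) →
        ∃ e : AdicCompletion
            ((IsLocalRing.maximalIdeal (X'.presheaf.stalk x)).map (Ideal.Quotient.mk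
              ((IsLocalRing.maximalIdeal (Y'.presheaf.stalk (f'.base x))).map (f'.stalkMap x).hom)))
            (X'.presheaf.stalk x ⧸
              (IsLocalRing.maximalIdeal (Y'.presheaf.stalk (f'.base x))).map (f'.stalkMap x).hom) ≃+*
          MvPowerSeries (Fin 2) (Y'.presheaf.stalk (f'.base x) ⧸ IsLocalRing.maximalIdeal (Y'.presheaf.stalk (f'.base x))) ⧸
            Ideal.span {(MvPowerSeries.X 0 * MvPowerSeries.X 1 :
              MvPowerSeries (Fin 2) (Y'.presheaf.stalk (f'.base x) ⧸ IsLocalRing.maximalIdeal (Y'.presheaf.stalk (f'.base x))))},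
          e.toRingHom.comp ((algebraMap (X'.presheaf.stalk x ⧸
              (IsLocalRing.maximalIdeal (Y'.presheaf.stalk (f'.base x))).map (f'.stalkMap x).hom) _).comp
            (Ideal.quotientMap ((IsLocalRing.maximalIdeal (Y'.presheaf.stalk (f'.base x))).map (f'.stalkMap x).hom)
              (f'.stalkMap x).hom Ideal.le_comap_map)) =
          algebraMap (Y'.presheaf.stalk (f'.base x) ⧸ IsLocalRing.maximalIdeal (Y'.presheaf.stalk (f'.base x))) _) ∧
      Smooth (f' ∣_ ⟨D'ᶜ, hD'.isClosed.isOpen_compl⟩) ∧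
      (∀ i : Fin m, τ i ≫ f' = 𝟙 Y') ∧
      (Pairwise fun i j : Fin m => Disjoint (Set.range (τ i)) (Set.range (τ j))) ∧
      (∀ i : Fin m, ∃ U : X'.Opens, Set.range (τ i) ⊆ (U : Set X') ∧ Smooth (U.ι ≫ f')) ∧
      (∀ g : G', (ρX' g).hom ≫ f' = f' ≫ (ρY' g).hom) ∧
      (∀ (g : G') (i : Fin m), ∃ j : Fin m, τ i ≫ (ρX' g).hom = (ρY' g).hom ≫ τ j) ∧
      ∃ (φ' : G' →* G) (π' : X' ⟶ X) (_ : IsDominant π'),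
        Function.Surjective φ' ∧ IsAlteration π' ∧ f' ≫ q' = π' ≫ f ∧
        (∀ g : G', (ρX' g).hom ≫ π' = π' ≫ (ρ (φ' g)).hom) ∧
        (∀ a : X'.functionField, (∀ g : G', RatFn.functionFieldMap (ρX' g).hom a = a) →
          ∃ (n : ℕ) (c : X.functionField), (∀ g : G, RatFn.functionFieldMap (ρ g).hom c = c) ∧
            a ^ ringExpChar X.functionField ^ n = RatFn.functionFieldMap π' c) ∧
        π'.base ⁻¹' Z ⊆ DeJong1996.semiStableBoundary f' D' τ := by
  obtain ⟨X', _, φ, ρX', Y, _, q, ρY, fc, hφ, hφG, hprojX', hprojY, hρY, hfcG, hcomm, hdimY, hfib, hgi⟩ :=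
    stub_pair_equivariantFibration k d X f hproj G ρ hρ hdim
  obtain ⟨G₁, _, _, X₁, Y₁, _, _, f₁, q₁, ρX₁, ρY₁, D₁, hD₁, m, σ, hprojX₁, hprojY₁, hρY₁, hdimY₁, hD₁ne, hD₁G, hss₁, hqs₁, hsm₁, hgi₁, hσf, hσdisj, hσsm, hf₁G, hσG, φ₁, π₁, _, hφsurj, hπalt, hπcomm, hπG, hgal, hZbd⟩ :=
    stub_pair_equivariantSemiStableReduction_of_deJong59 h59 k d X f G ρ Z hZ hZne hZG X' φ ρX' Y q ρY fc hφ hφG hprojX'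
      hprojY hρY hfcG hcomm hdimY hfib hgi
  have hbase := ih Y₁ q₁ hprojY₁ G₁ ρY₁ hρY₁ D₁ hD₁ hD₁ne (fun g => (hD₁G g).subset) hdimY₁
  exact pair_regularBaseChange k X f G ρ Z G₁ X₁ Y₁ f₁ q₁ ρX₁ ρY₁ D₁ hD₁ m σ
    hprojX₁ hss₁ hqs₁ hsm₁ hgi₁ hσf hσdisj hσsm hf₁G hσG φ₁ π₁ hφsurj hπalt hπcomm hπG hgal hZbd hbase

end Summit.ResolutionOfSingularities.ResolutionOfSingularities.Theorems

end
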